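import Mathlib
import Literature.Computability.AlgebraicComplexity.PrattTrapezoidVal
import Literature.Computability.AlgebraicComplexity.PrattTrapezoidValBounds
import Summits.MatrixMultiplication.MatrixMultiplication.Theorems.SoloBlindPrattValEventually

/-!
# Carry-free digit-box powering of an ARBITRARY trapezoid-free integer gadget

K. Pratt, *On generalized corners and matrix multiplication*, arXiv:2309.03878, Def. 3.2 / 4.2,
Prop. 3.5, Prop. 4.3; tree `IsEquilateralTrapezoidFree`, `prattVal`.

The tree's certified growth exponents for `Val(ℤ/nℤ)` (`PrattValExponent.prattVal_ge_rpow`,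
`PrattValLocalUSP.prattVal_ge_rpow_of_digitDesign`, `PrattValCW.prattVal_ge_rpow_sevenSixths`) all
power a SIMULTANEOUS-TPP (STPP) digit design: the STPP itself kills every carry
(`addSimultaneousTPP_digitBox`).  A general equilateral-trapezoid-free triple need not be
STPP-induced (the census of the gate `gate-prattval` found GLUED extremisers in `ℤ/8`, `ℤ/12`,
`ℤ/16`), and for such configurations no powering lemma was in the kernel.  This file supplies it,
in Pratt's INTEGER model (Def. 4.2, in the def-free form used by `SoloBlindPrattValInteger`:
`A, B, C ⊆ {0, …, n} ⊂ ℤ`, trapezoid-freeness of `(A, B, C − n)`, solutions of `a + b + c = n`).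

**Gadget.** `A, B, C ⊆ [0, n]`, `(A, B, C − n)` equilateral trapezoid-free, `T` solutions of
`a + b + c = n`, and a base `β > n` such that `n + β ∉ A + B + C` (the ONE excluded sum; automatic
for `β = 2n + 1` since `a + b + c ≤ 3n`, and `β = n + 1` is admissible iff `2n + 1 ∉ A + B + C`).

**Powering** (`step_etf`, `step_count`, `exists_level`).  Reading `k` gadget digits in base `β`,
`x = Σ_{j<k} x_j β^j`, gives `A_k, B_k, C_k ⊆ [0, n_k]`, `n_k = n(β^k − 1)/(β − 1) ≤ β^k − 1`, with
`(A_k, B_k, C_k − n_k)` equilateral trapezoid-free and at least `T^k` solutions of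
`a + b + c = n_k`.  No carry can occur: a digit column sums to `s = a_j + b_j + c_j − n ∈ [−n, 2n]`
with `s ≡ 0 (mod β)`, and `−β < −n`, `2β > 2n`, `s ≠ β` leave only `s = 0`; so the digit map
reflects zero sums and the lifting lemma `soloVal_etf_lift` (with Pratt's Prop. 3.5 product,
`IsEquilateralTrapezoidFree.product`) transports trapezoid-freeness, while solutions multiply.

**Cyclic read-out** (`le_prattVal_zmod`, `pow_le_prattVal`).  An integer configuration in
`[0, N]` maps injectively into `ℤ/Mℤ` for `M > 2N` with zero sums reflected, so
`Val(ℤ/Mℤ) ≥ T^k` for all `M ≥ 2β^k`.  The companion file `…PrattValGadgetExponent` turns this into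
`∃ K > 0, ∀ M ≥ 1: K · M^{log T / log β} ≤ Val(ℤ/Mℤ)`: ANY finite trapezoid-free integer
configuration with `T > β` certifies a growth exponent `θ ≥ log T/log β > 1` for Pratt's
`Val(ℤ_n)` — the census-to-exponent link of the gate `gate-prattval` (README (c)(iv), RESULTS §F1)
for non-STPP extremisers.  (No such gadget is known in the exactly solved range: `Val(n) = n + 1`
for `n ≤ 16`, so `T ≤ n + 1 ≤ β` there.)

No bearing on `ω`: statements about Pratt's functional `Val` only.
-/

set_option linter.dupNamespace false

namespace Summit.MatrixMultiplication.MatrixMultiplication.Theorems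

open Finset Literature.Computability.AlgebraicComplexity

namespace PrattValGadget

/-! ### Digit arithmetic in base `β > n` -/

/-- Base-`β` digits are unique: `a + βx = a' + βx'` with `a, a' ∈ [0, n]`, `n < β` forces
`a = a'` and `x = x'`. -/
theorem digit_inj {n β : ℕ} (hβ : n < β) {a a' x x' : ℤ} (ha : 0 ≤ a ∧ a ≤ n)
    (ha' : 0 ≤ a' ∧ a' ≤ n) (h : a + β * x = a' + β * x') : a = a' ∧ x = x' := by
  have hβ' : (n : ℤ) < β := by exact_mod_cast hβ
  have e : a - a' = β * (x' - x) := by linear_combination h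
  have key : x = x' := by
    rcases lt_trichotomy x x' with hlt | heq | hgt
    · exfalso
      have : (β : ℤ) * 1 ≤ β * (x' - x) := mul_le_mul_of_nonneg_left (by omega) (by omega)
      linarith [ha.2, ha'.1]
    · exact heq
    · exfalso
      have : (β : ℤ) * 1 ≤ β * (x - x') := mul_le_mul_of_nonneg_left (by omega) (by omega)
      linarith [ha.1, ha'.2]
  subst key
  exact ⟨by linarith, rfl⟩

/-- **No carry.**  If `s + βS = 0` with `−n ≤ s ≤ 2n`, `s ≠ β` and `n < β`, then `s = 0` and
`S = 0` (the residues `−β < −n` and `2β > 2n` are out of range and `β` is excluded). -/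
theorem noCarry {n β : ℕ} (hβ : n < β) {s S : ℤ} (hs1 : -(n : ℤ) ≤ s) (hs2 : s ≤ 2 * n)
    (hsβ : s ≠ β) (h : s + β * S = 0) : s = 0 ∧ S = 0 := by
  have hβ' : (n : ℤ) < β := by exact_mod_cast hβ
  rcases lt_trichotomy S 0 with hlt | heq | hgt
  · exfalso
    rcases eq_or_lt_of_le (show S ≤ -1 by omega) with h1 | h2
    · apply hsβ
      rw [h1] at h
      linarith
    · have : (β : ℤ) * 2 ≤ β * (-S) := mul_le_mul_of_nonneg_left (by omega) (by omega)
      linarith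
  · subst heq
    exact ⟨by simpa using h, rfl⟩
  · exfalso
    have : (β : ℤ) * 1 ≤ β * S := mul_le_mul_of_nonneg_left (by omega) (by omega)
    linarith

/-! ### One powering step: append a gadget digit below a configuration -/

/-- The digit map sends `[0, n] × [0, N]` into `[0, n + βN]`. -/
theorem digit_range {n β N : ℕ} {S : Finset ℤ} {S' : Finset ℤ}
    (hS : ∀ x ∈ S, 0 ≤ x ∧ x ≤ (n : ℤ)) (hS' : ∀ x ∈ S', 0 ≤ x ∧ x ≤ (N : ℤ)) :
    ∀ x ∈ (S ×ˢ S').image (fun p : ℤ × ℤ => p.1 + (β : ℤ) * p.2),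
      0 ≤ x ∧ x ≤ ((n + β * N : ℕ) : ℤ) := by
  intro x hx
  obtain ⟨p, hp, rfl⟩ := mem_image.1 hx
  obtain ⟨hp1, hp2⟩ := mem_product.1 hp
  obtain ⟨h1, h2⟩ := hS _ hp1
  obtain ⟨h3, h4⟩ := hS' _ hp2
  have hβ0 : (0 : ℤ) ≤ β := by omega
  push_cast
  constructor
  · nlinarith
  · nlinarith

/-- The shifted third set of the digit configuration is the digit image of the shifted third sets:
`(C − n) ×ˢ (C' − N) ↦ (C ×ˢ C')·ψ − (n + βN)` for the digit map `ψ(c, c') = c + βc'`. -/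
theorem image_shift_product (n β N : ℕ) (C C' : Finset ℤ) :
    ((C.image fun c => c - (n : ℤ)) ×ˢ (C'.image fun c => c - (N : ℤ))).image
        (fun p : ℤ × ℤ => p.1 + (β : ℤ) * p.2) =
      ((C ×ˢ C').image (fun p : ℤ × ℤ => p.1 + (β : ℤ) * p.2)).image
        fun c => c - ((n + β * N : ℕ) : ℤ) := by
  ext x
  simp only [mem_image, mem_product, Prod.exists]
  constructor
  · rintro ⟨u, v, ⟨⟨c, hc, rfl⟩, ⟨c', hc', rfl⟩⟩, rfl⟩
    refine ⟨c + (β : ℤ) * c', ⟨c, c', ⟨hc, hc'⟩, rfl⟩, ?_⟩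
    push_cast
    ring
  · rintro ⟨y, ⟨c, c', ⟨hc, hc'⟩, rfl⟩, rfl⟩
    refine ⟨c - n, c' - N, ⟨⟨c, hc, rfl⟩, ⟨c', hc', rfl⟩⟩, ?_⟩
    push_cast
    ring

/-- **One powering step (trapezoid-freeness).**  Let `(A, B, C)` be a gadget in `[0, n]`
(`(A, B, C − n)` equilateral trapezoid-free, `n + β ∉ A + B + C`, `n < β`) and `(A', B', C')` a
configuration in `[0, N]` with `(A', B', C' − N)` equilateral trapezoid-free.  Then the digit
configuration `A + βA'`, `B + βB'`, `C + βC'` in `[0, n + βN]` is equilateral trapezoid-free after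
shifting its third set by `n + βN`.  (Prop. 3.5 product + the lifting lemma: the digit map reflects
zero sums because no carry can occur, `noCarry`.) -/
theorem step_etf {n β : ℕ} (hβ : n < β) {A B C : Finset ℤ}
    (hA : ∀ a ∈ A, 0 ≤ a ∧ a ≤ (n : ℤ)) (hB : ∀ b ∈ B, 0 ≤ b ∧ b ≤ (n : ℤ))
    (hC : ∀ c ∈ C, 0 ≤ c ∧ c ≤ (n : ℤ))
    (hE : IsEquilateralTrapezoidFree A B (C.image fun c => c - (n : ℤ)))
    (hm : ∀ a ∈ A, ∀ b ∈ B, ∀ c ∈ C, a + b + c ≠ (n : ℤ) + β)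
    {N : ℕ} {A' B' C' : Finset ℤ}
    (hA' : ∀ a ∈ A', 0 ≤ a ∧ a ≤ (N : ℤ)) (hB' : ∀ b ∈ B', 0 ≤ b ∧ b ≤ (N : ℤ))
    (hC' : ∀ c ∈ C', 0 ≤ c ∧ c ≤ (N : ℤ))
    (hE' : IsEquilateralTrapezoidFree A' B' (C'.image fun c => c - (N : ℤ))) :
    IsEquilateralTrapezoidFree
      ((A ×ˢ A').image (fun p : ℤ × ℤ => p.1 + (β : ℤ) * p.2))
      ((B ×ˢ B').image (fun p : ℤ × ℤ => p.1 + (β : ℤ) * p.2))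
      (((C ×ˢ C').image (fun p : ℤ × ℤ => p.1 + (β : ℤ) * p.2)).image
        fun c => c - ((n + β * N : ℕ) : ℤ)) := by
  rw [← image_shift_product]
  refine soloVal_etf_lift (hE.product hE') _ _ _ ?_
  intro a ha b hb c hc habc
  obtain ⟨ha1, ha2⟩ := mem_product.1 ha
  obtain ⟨hb1, hb2⟩ := mem_product.1 hb
  obtain ⟨hc1, hc2⟩ := mem_product.1 hc
  obtain ⟨c₀, hc₀, hc₀e⟩ := mem_image.1 hc1
  obtain ⟨c₀', hc₀', hc₀e'⟩ := mem_image.1 hc2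
  obtain ⟨hA1, hA2⟩ := hA _ ha1
  obtain ⟨hB1, hB2⟩ := hB _ hb1
  obtain ⟨hC1, hC2⟩ := hC _ hc₀
  obtain ⟨hA1', hA2'⟩ := hA' _ ha2
  obtain ⟨hB1', hB2'⟩ := hB' _ hb2
  obtain ⟨hC1', hC2'⟩ := hC' _ hc₀'
  -- digit columns: `s` (gadget digit) and `S` (the configuration above it)
  have hsum : (a.1 + b.1 + c.1) + (β : ℤ) * (a.2 + b.2 + c.2) = 0 := by linear_combination habc
  have hs1 : -(n : ℤ) ≤ a.1 + b.1 + c.1 := by rw [← hc₀e]; linarith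
  have hs2 : a.1 + b.1 + c.1 ≤ 2 * n := by rw [← hc₀e]; linarith
  have hsβ : a.1 + b.1 + c.1 ≠ β := by
    intro h
    apply hm _ ha1 _ hb1 _ hc₀
    rw [← hc₀e] at h
    linarith
  obtain ⟨hs0, hS0⟩ := noCarry hβ hs1 hs2 hsβ hsum
  exact Prod.ext (by simpa using hs0) (by simpa using hS0)

/-- **One powering step (count).**  Solutions multiply: every pair (gadget solution, solution of
the configuration) gives a distinct solution of the digit configuration (digits are unique,
`digit_inj`). -/
theorem step_count {n β : ℕ} (hβ : n < β) {A B C : Finset ℤ}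
    (hA : ∀ a ∈ A, 0 ≤ a ∧ a ≤ (n : ℤ)) (hB : ∀ b ∈ B, 0 ≤ b ∧ b ≤ (n : ℤ))
    (hC : ∀ c ∈ C, 0 ≤ c ∧ c ≤ (n : ℤ))
    (N : ℕ) (A' B' C' : Finset ℤ) :
    #((A ×ˢ B ×ˢ C).filter fun t => t.1 + t.2.1 + t.2.2 = (n : ℤ)) *
        #((A' ×ˢ B' ×ˢ C').filter fun t => t.1 + t.2.1 + t.2.2 = (N : ℤ)) ≤
      #((((A ×ˢ A').image (fun p : ℤ × ℤ => p.1 + (β : ℤ) * p.2)) ×ˢ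
          ((B ×ˢ B').image (fun p : ℤ × ℤ => p.1 + (β : ℤ) * p.2)) ×ˢ
          ((C ×ˢ C').image (fun p : ℤ × ℤ => p.1 + (β : ℤ) * p.2))).filter
        fun t => t.1 + t.2.1 + t.2.2 = ((n + β * N : ℕ) : ℤ)) := by
  rw [← card_product]
  refine Finset.card_le_card_of_injOn
    (fun q => (q.1.1 + (β : ℤ) * q.2.1, q.1.2.1 + (β : ℤ) * q.2.2.1,
      q.1.2.2 + (β : ℤ) * q.2.2.2)) ?_ ?_
  · intro q hq
    simp only [Finset.mem_coe, mem_product, mem_filter] at hq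
    obtain ⟨⟨⟨ha, hb, hc⟩, hs⟩, ⟨⟨ha', hb', hc'⟩, hs'⟩⟩ := hq
    rw [Finset.mem_coe, mem_filter]
    refine ⟨mem_product.2 ⟨mem_image.2 ⟨(q.1.1, q.2.1), mem_product.2 ⟨ha, ha'⟩, rfl⟩,
      mem_product.2 ⟨mem_image.2 ⟨(q.1.2.1, q.2.2.1), mem_product.2 ⟨hb, hb'⟩, rfl⟩,
      mem_image.2 ⟨(q.1.2.2, q.2.2.2), mem_product.2 ⟨hc, hc'⟩, rfl⟩⟩⟩, ?_⟩
    push_cast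
    linear_combination hs + (β : ℤ) * hs'
  · intro q hq q' hq' hqq
    simp only [Finset.mem_coe, mem_product, mem_filter] at hq hq'
    obtain ⟨⟨⟨ha, hb, hc⟩, -⟩, -⟩ := hq
    obtain ⟨⟨⟨ha', hb', hc'⟩, -⟩, -⟩ := hq'
    simp only [Prod.mk.injEq] at hqq
    obtain ⟨e1, e2, e3⟩ := hqq
    obtain ⟨f1, g1⟩ := digit_inj hβ (hA _ ha) (hA _ ha') e1
    obtain ⟨f2, g2⟩ := digit_inj hβ (hB _ hb) (hB _ hb') e2
    obtain ⟨f3, g3⟩ := digit_inj hβ (hC _ hc) (hC _ hc') e3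
    exact Prod.ext (Prod.ext f1 (Prod.ext f2 f3)) (Prod.ext g1 (Prod.ext g2 g3))

/-! ### All levels -/

/-- The one-point configuration `({0}, {0}, {0})` in `[0, 0]` (level `0` of the powering): it is
equilateral trapezoid-free and has exactly one solution. -/
theorem level_zero :
    IsEquilateralTrapezoidFree ({0} : Finset ℤ) {0} (({0} : Finset ℤ).image fun c => c - ((0 : ℕ) : ℤ))
      ∧ #((({0} : Finset ℤ) ×ˢ ({0} : Finset ℤ) ×ˢ ({0} : Finset ℤ)).filter
          fun t => t.1 + t.2.1 + t.2.2 = ((0 : ℕ) : ℤ)) = 1 := by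
  constructor
  · have h1 : (({0} : Finset ℤ).image fun c => c - ((0 : ℕ) : ℤ)) = {0} := by simp
    rw [h1]
    refine ⟨fun _ _ _ _ => ?_, fun _ _ _ _ => ?_, fun _ _ _ _ => ?_⟩ <;>
      exact (card_filter_le _ _).trans (by simp)
  · rfl

/-- **Level `k` of the powering.**  For a gadget `(A, B, C)` in `[0, n]` with base `β > n`
(`(A, B, C − n)` equilateral trapezoid-free, `n + β ∉ A + B + C`) and every `k` there is a
configuration `(A_k, B_k, C_k)` in `[0, N]`, `N + 1 ≤ β^k`, with `(A_k, B_k, C_k − N)` equilateral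
trapezoid-free and at least `T^k` solutions of `a + b + c = N`, `T` = the number of gadget
solutions. -/
theorem exists_level {n β : ℕ} (hβ : n < β) {A B C : Finset ℤ}
    (hA : ∀ a ∈ A, 0 ≤ a ∧ a ≤ (n : ℤ)) (hB : ∀ b ∈ B, 0 ≤ b ∧ b ≤ (n : ℤ))
    (hC : ∀ c ∈ C, 0 ≤ c ∧ c ≤ (n : ℤ))
    (hE : IsEquilateralTrapezoidFree A B (C.image fun c => c - (n : ℤ)))
    (hm : ∀ a ∈ A, ∀ b ∈ B, ∀ c ∈ C, a + b + c ≠ (n : ℤ) + β) (k : ℕ) :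
    ∃ (N : ℕ) (A' B' C' : Finset ℤ), N + 1 ≤ β ^ k ∧
      (∀ a ∈ A', 0 ≤ a ∧ a ≤ (N : ℤ)) ∧ (∀ b ∈ B', 0 ≤ b ∧ b ≤ (N : ℤ)) ∧
      (∀ c ∈ C', 0 ≤ c ∧ c ≤ (N : ℤ)) ∧
      IsEquilateralTrapezoidFree A' B' (C'.image fun c => c - (N : ℤ)) ∧
      #((A ×ˢ B ×ˢ C).filter fun t => t.1 + t.2.1 + t.2.2 = (n : ℤ)) ^ k ≤
        #((A' ×ˢ B' ×ˢ C').filter fun t => t.1 + t.2.1 + t.2.2 = (N : ℤ)) := by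
  induction k with
  | zero =>
    refine ⟨0, {0}, {0}, {0}, by simp, by simp, by simp, by simp, level_zero.1, ?_⟩
    rw [level_zero.2, pow_zero]
  | succ k ih =>
    obtain ⟨N, A', B', C', hN, hA', hB', hC', hE', hcount⟩ := ih
    refine ⟨n + β * N, (A ×ˢ A').image (fun p : ℤ × ℤ => p.1 + (β : ℤ) * p.2),
      (B ×ˢ B').image (fun p : ℤ × ℤ => p.1 + (β : ℤ) * p.2),
      (C ×ˢ C').image (fun p : ℤ × ℤ => p.1 + (β : ℤ) * p.2), ?_,
      digit_range hA hA', digit_range hB hB', digit_range hC hC',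
      step_etf hβ hA hB hC hE hm hA' hB' hC' hE', ?_⟩
    · -- `n + βN + 1 ≤ n + β(β^k − 1) + 1 ≤ β^(k+1)` as `n + 1 ≤ β`
      have h1 : β * (N + 1) ≤ β * β ^ k := Nat.mul_le_mul_left _ hN
      rw [pow_succ]
      nlinarith
    · rw [pow_succ]
      exact (Nat.mul_le_mul_right _ hcount).trans
        ((mul_comm _ _).le.trans (step_count hβ hA hB hC N A' B' C'))

/-! ### Cyclic read-out -/

/-- Reduction mod `M` is injective on integers at distance `< M`. -/
theorem eq_of_intCast_zmod_eq {M : ℕ} {x y : ℤ} (h : (x : ZMod M) = (y : ZMod M))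
    (h1 : -(M : ℤ) < y - x) (h2 : y - x < M) : x = y := by
  have hdvd : (M : ℤ) ∣ y - x := (ZMod.intCast_eq_intCast_iff_dvd_sub x y M).1 h
  have := Int.eq_zero_of_abs_lt_dvd hdvd (abs_lt.2 ⟨h1, h2⟩)
  linarith

/-- Reduction mod `M` is injective on any set of integers contained in an interval `[u, u + N]`
with `N < M`. -/
theorem intCast_injOn {M N : ℕ} (hM : N < M) {u : ℤ} {S : Finset ℤ}
    (hS : ∀ x ∈ S, u ≤ x ∧ x ≤ u + N) : Set.InjOn (fun x : ℤ => (x : ZMod M)) S := by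
  intro x hx y hy h
  obtain ⟨h1, h2⟩ := hS _ (Finset.mem_coe.1 hx)
  obtain ⟨h3, h4⟩ := hS _ (Finset.mem_coe.1 hy)
  have hMZ : (N : ℤ) < M := by exact_mod_cast hM
  exact eq_of_intCast_zmod_eq h (by linarith) (by linarith)

/-- **Integer configurations bound `Val(ℤ/Mℤ)`.**  A configuration `(A', B', C')` in `[0, N]` with
`(A', B', C' − N)` equilateral trapezoid-free and `T'` solutions of `a + b + c = N` gives
`T' ≤ Val(ℤ/Mℤ)` for every `M > 2N`: reduction mod `M` is injective on `[0, N]` and on `[−N, 0]`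
and reflects zero sums (`a + b + (c − N) ∈ [−N, 2N]` vanishes mod `M` only if it vanishes). -/
theorem le_prattVal_zmod {N : ℕ} {A' B' C' : Finset ℤ}
    (hA' : ∀ a ∈ A', 0 ≤ a ∧ a ≤ (N : ℤ)) (hB' : ∀ b ∈ B', 0 ≤ b ∧ b ≤ (N : ℤ))
    (hC' : ∀ c ∈ C', 0 ≤ c ∧ c ≤ (N : ℤ))
    (hE' : IsEquilateralTrapezoidFree A' B' (C'.image fun c => c - (N : ℤ)))
    {M : ℕ} [NeZero M] (hM : 2 * N < M) :
    #((A' ×ˢ B' ×ˢ C').filter fun t => t.1 + t.2.1 + t.2.2 = (N : ℤ)) ≤ prattVal (ZMod M) := by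
  have hMZ : (2 * N : ℤ) < M := by exact_mod_cast hM
  have hC'' : ∀ c ∈ C'.image (fun c => c - (N : ℤ)), -(N : ℤ) ≤ c ∧ c ≤ -(N : ℤ) + N := by
    intro c hc
    obtain ⟨c₀, hc₀, rfl⟩ := mem_image.1 hc
    obtain ⟨hc1, hc2⟩ := hC' _ hc₀
    constructor <;> linarith
  -- reflection of zero sums on the relevant ranges
  have hrefl : ∀ a ∈ A', ∀ b ∈ B', ∀ c ∈ C'.image (fun c => c - (N : ℤ)),
      ((a : ℤ) : ZMod M) + ((b : ℤ) : ZMod M) + ((c : ℤ) : ZMod M) = 0 → a + b + c = 0 := by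
    intro a ha b hb c hc h
    obtain ⟨ha1, ha2⟩ := hA' _ ha
    obtain ⟨hb1, hb2⟩ := hB' _ hb
    obtain ⟨hc1, hc2⟩ := hC'' _ hc
    have hN0 : (0 : ℤ) ≤ N := by positivity
    have hcast : (((a + b + c) : ℤ) : ZMod M) = ((0 : ℤ) : ZMod M) := by
      push_cast
      exact h
    exact eq_of_intCast_zmod_eq hcast (by linarith) (by linarith)
  have hetf := soloVal_etf_lift hE' (fun x : ℤ => (x : ZMod M)) (fun x : ℤ => (x : ZMod M))
    (fun x : ℤ => (x : ZMod M)) hrefl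
  refine le_trans ?_ ((soloVal_card_filter_le_card_zeroSumTriples_lift
    (fun x : ℤ => (x : ZMod M)) (fun x : ℤ => (x : ZMod M)) (fun x : ℤ => (x : ZMod M))
    (intCast_injOn (u := 0) (by omega : N < M) (by simpa using hA'))
    (intCast_injOn (u := 0) (by omega : N < M) (by simpa using hB'))
    (intCast_injOn (by omega : N < M) hC'')).trans (card_zeroSumTriples_le_prattVal hetf))
  -- solutions of `a + b + c = N` ↦ `(a, b, c − N)`
  refine Finset.card_le_card_of_injOn (fun t => (t.1, t.2.1, t.2.2 - (N : ℤ))) ?_ ?_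
  · intro t ht
    simp only [coe_filter, Set.mem_setOf_eq, mem_product] at ht
    obtain ⟨⟨ha, hb, hc⟩, hs⟩ := ht
    simp only [coe_filter, Set.mem_setOf_eq, mem_product, mem_image]
    refine ⟨⟨ha, hb, ⟨_, hc, rfl⟩⟩, ?_⟩
    have : t.1 + t.2.1 + (t.2.2 - (N : ℤ)) = 0 := by linarith
    rw [← Int.cast_add, ← Int.cast_add, this, Int.cast_zero]
  · intro t _ t' _ htt
    simp only [Prod.mk.injEq, sub_left_inj] at htt
    exact Prod.ext htt.1 (Prod.ext htt.2.1 htt.2.2)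

/-- **Powers of a gadget in cyclic groups.**  For a gadget in `[0, n]` with base `β > n`
(`(A, B, C − n)` equilateral trapezoid-free, `n + β ∉ A + B + C`) with at least `T` solutions:
`T^k ≤ Val(ℤ/Mℤ)` for every `k` and every `M ≥ 2β^k`. -/
theorem pow_le_prattVal {n β : ℕ} (hβ : n < β) {A B C : Finset ℤ}
    (hA : ∀ a ∈ A, 0 ≤ a ∧ a ≤ (n : ℤ)) (hB : ∀ b ∈ B, 0 ≤ b ∧ b ≤ (n : ℤ))
    (hC : ∀ c ∈ C, 0 ≤ c ∧ c ≤ (n : ℤ))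
    (hE : IsEquilateralTrapezoidFree A B (C.image fun c => c - (n : ℤ)))
    (hm : ∀ a ∈ A, ∀ b ∈ B, ∀ c ∈ C, a + b + c ≠ (n : ℤ) + β)
    {T : ℕ} (hT : T ≤ #((A ×ˢ B ×ˢ C).filter fun t => t.1 + t.2.1 + t.2.2 = (n : ℤ)))
    (k M : ℕ) [NeZero M] (hM : 2 * β ^ k ≤ M) : T ^ k ≤ prattVal (ZMod M) := by
  obtain ⟨N, A', B', C', hN, hA', hB', hC', hE', hcount⟩ := exists_level hβ hA hB hC hE hm k
  exact (Nat.pow_le_pow_left hT k).trans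
    (hcount.trans (le_prattVal_zmod hA' hB' hC' hE' (by omega)))

end PrattValGadget

end Summit.MatrixMultiplication.MatrixMultiplication.Theorems
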